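import Mathlib
import Summits.NavierStokesRegularity.NavierStokesRegularity.Theses.ClockStretchingLaw
import Summits.NavierStokesRegularity.NavierStokesRegularity.Theorems.ClockStretchingLawClockCeilingFarPastStretchingRung
import Summits.NavierStokesRegularity.NavierStokesRegularity.Theorems.ClockStretchingLawClockLawStubZoomExtraction
import Summits.NavierStokesRegularity.NavierStokesRegularity.Theorems.ClockStretchingLawClockLawStubLimitSingular
import Summits.NavierStokesRegularity.NavierStokesRegularity.Theorems.ClockStretchingLawClockLawStubClassPressure
import Summits.NavierStokesRegularity.NavierStokesRegularity.Theorems.ClockStretchingLawClockCeilingStubUniformBounds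
import Summits.NavierStokesRegularity.NavierStokesRegularity.Theorems.ClockStretchingLawClockCeilingZoomDerivLimit
import Summits.NavierStokesRegularity.NavierStokesRegularity.Theorems.ClockStretchingLawClockCeilingZoomLimitEnergy
import Literature.Analysis.FluidPDE.TypeIAncientMild
import Literature.Analysis.FluidPDE.DirectionDissipation
import HarnessLib

/-!
# Route ClockStretchingLaw, crux `ClockCeiling` (stmt-NavierStokesRegularity-10570) — a singular
# Type-I model stretches its vorticity at the full gauge rate near the singular time

Portrait clause for the crux's Type-I class `𝒦_C` (jointly smooth on `(−∞,0) × ℝ³`,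
divergence-free, KNSS/Oseen-mild, `‖u(t,x)‖ ≤ C/√(−t)`, scale-invariant local energies
`A, E ≤ C`), complementing the far-past rung `farPastStretchingRung`:

**`singularStretchingNearZero`.** If `u ∈ 𝒦_C` is SINGULAR at the space–time origin (unbounded
on every backward parabolic cylinder `Q(0, r)`), then for every `T < 0` and every `θ < 1` there is
a point `(t, x)` with `T < t < 0`, `ω(t,x) ≠ 0` and gauge stretching rate along the vorticity
direction `(−t)⟪∇u(t,x) ξ, ξ⟫ > θ`. In words: `limsup_{t → 0⁻} sup_{ω ≠ 0} (−t)⟪S ξ, ξ⟫ ≥ 1`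
along every singular Type-I model — the ancient-solution counterpart of the Beale–Kato–Majda
mechanism, with the sharp constant `1` of the maximum principle.

## Proof

By contradiction: a uniform bound `(−t)⟪∇u ξ, ξ⟫ ≤ θ < 1` on `(T, 0) × ℝ³ ∩ {ω ≠ 0}` is
scale-invariant, so it holds for the zooms `u_c = c u(c² ·, c ·)` on `(T/c², 0)`. Along
`c_j = 1/(j+1) → 0` a subsequence of zooms converges pointwise to an element `W ∈ 𝒦_C`
(`ClockLaw.Birth.stub_zoomExtraction`), singular at the origin by persistence of singularities
(`ClockLaw.Birth.stub_limitSingular` with the landed class pressure `classPressure_holds`), hence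
`W ≢ 0`. Gradients converge (`tendsto_fderiv_apply_of_typeI` under the class-uniform KNSS bound
`‖∇²u_c‖ ≤ K(C)(−t)^{−3/2}` of `uniformBounds_exists_mixed`), so wherever `curl W(t,x) ≠ 0` the
curls, the vorticity directions and the stretching rates of the zooms converge to those of `W`,
and `W` inherits `(−t)⟪∇W ξ, ξ⟫ ≤ θ` for ALL `t < 0`. The far-past rung
(`farPastStretchingRung`, `T = 0`) forces `W ≡ 0` — contradiction.

## References

* G. Koch, N. Nadirashvili, G. Seregin, V. Šverák, Acta Math. 203 (2009) 83–105, Prop. 4.1,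
  Lemma 3.1, Remark 6.1 (arXiv:0709.3599). [KochNadirashviliSereginSverak2009]
* D. Albritton, T. Barker, *Global weak Besov solutions of the Navier–Stokes equations and
  applications*, ARMA 232 (2019), Lemma 2.2, Prop. 2.3 (persistence of singularities,
  arXiv:1811.00502). [AlbrittonBarker2019]
* J. T. Beale, T. Kato, A. Majda, Comm. Math. Phys. 94 (1984) 61–66. [BealeKatoMajda1984]
-/

noncomputable section

-- the summit and its single sub-problem share the name (CONVENTIONS §1), as in every Theorems file
set_option linter.dupNamespace false

open Set Function Filter Topology Metric
open scoped RealInnerProductSpace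

namespace Summit.NavierStokesRegularity.NavierStokesRegularity.Theorems

open Literature.Analysis Literature.Analysis.FluidPDE
open Summit.NavierStokesRegularity.NavierStokesRegularity.Theorems.ClockLaw.Birth

/-- Normalising a positive multiple of a vector gives the same unit vector:
`‖a v‖⁻¹ (a v) = ‖v‖⁻¹ v` for `0 < a`. [folklore] -/
theorem inv_norm_smul_smul_of_pos {a : ℝ} (ha : 0 < a) (v : EuclideanSpace ℝ (Fin 3)) :
    ‖a • v‖⁻¹ • (a • v) = ‖v‖⁻¹ • v := by
  rw [norm_smul, Real.norm_of_nonneg ha.le, mul_inv, smul_smul, mul_comm a⁻¹, mul_assoc,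
    inv_mul_cancel₀ ha.ne', mul_one]

/-- **Gradient of the Navier–Stokes zoom at the origin**:
`∇(c u(c²t, c ·))(x) = c² ∇u(c²t)(c x)` (chain rule for the homothety; no differentiability
needed, `fderiv_stPull`). [folklore] -/
theorem fderiv_nsZoom_origin (c : ℝ) (u : ℝ → EuclideanSpace ℝ (Fin 3) → EuclideanSpace ℝ (Fin 3))
    (t : ℝ) (x : EuclideanSpace ℝ (Fin 3)) :
    fderiv ℝ ((c • stPull (c ^ 2) c 0 0 u) t) x = (c * c) • fderiv ℝ (u (c ^ 2 * t)) (c • x) := by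
  have h1 : (c • stPull (c ^ 2) c 0 0 u) t = c • stPull (c ^ 2) c 0 0 u t := rfl
  rw [h1, fderiv_const_smul_field, Pi.smul_apply, fderiv_stPull, smul_smul, zero_add, zero_add]

/-- **Curl of the Navier–Stokes zoom at the origin**: `curl(c u(c²t, c ·))(x) = c² ω(c²t, c x)`
(`curl_smul_stPull`). [folklore] -/
theorem curl_nsZoom_origin (c : ℝ) (u : ℝ → EuclideanSpace ℝ (Fin 3) → EuclideanSpace ℝ (Fin 3))
    (t : ℝ) (x : EuclideanSpace ℝ (Fin 3)) :
    curl ((c • stPull (c ^ 2) c 0 0 u) t) x = (c * c) • curl (u (c ^ 2 * t)) (c • x) := by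
  rw [curl_smul_stPull, zero_add, zero_add]

/-- **The gauge stretching rate along the vorticity direction is zoom invariant**: at a point
where the zoom `u_c = c u(c² ·, c ·)` (`0 < c`) has nonzero vorticity,
`(−t)⟪∇u_c(t,x) ξ_c, ξ_c⟫ = (−c²t)⟪∇u(c²t, cx) ξ, ξ⟫` with `ξ_c(t,x) = ξ(c²t, cx)`
(KNSS 2009 §1 (1.2): the scaling symmetry). [cite: KochNadirashviliSereginSverak2009, §1 (1.2) (arXiv:0709.3599)] -/
theorem gaugeStretching_nsZoom_origin {c : ℝ} (hc : 0 < c)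
    (u : ℝ → EuclideanSpace ℝ (Fin 3) → EuclideanSpace ℝ (Fin 3)) (t : ℝ)
    (x : EuclideanSpace ℝ (Fin 3)) :
    (-t) * ⟪fderiv ℝ ((c • stPull (c ^ 2) c 0 0 u) t) x
        (vorticityDirection (curl ((c • stPull (c ^ 2) c 0 0 u) t)) x),
        vorticityDirection (curl ((c • stPull (c ^ 2) c 0 0 u) t)) x⟫ =
      (-(c ^ 2 * t)) * ⟪fderiv ℝ (u (c ^ 2 * t)) (c • x)
        (vorticityDirection (curl (u (c ^ 2 * t))) (c • x)),
        vorticityDirection (curl (u (c ^ 2 * t))) (c • x)⟫ := by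
  have hcc : 0 < c * c := mul_pos hc hc
  have hξ : vorticityDirection (curl ((c • stPull (c ^ 2) c 0 0 u) t)) x =
      vorticityDirection (curl (u (c ^ 2 * t))) (c • x) := by
    rw [vorticityDirection_apply, vorticityDirection_apply, curl_nsZoom_origin,
      inv_norm_smul_smul_of_pos hcc]
  rw [hξ, fderiv_nsZoom_origin, FunLike.coe_smul, Pi.smul_apply, real_inner_smul_left]
  ring

/-- **A singular Type-I model stretches its vorticity at the full gauge rate near the singular
time** (portrait clause of crux `ClockCeiling` / the Type-I Liouville node). Let `u` be a Type-I
KNSS-mild ancient field (`IsTypeIAncientMild C u`) with the scale-invariant energy ledger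
`A, E ≤ C`, singular at the space–time origin. Then for every `T < 0` and `θ < 1` some point
`(t, x)` with `T < t < 0` has `curl u(t,x) ≠ 0` and `(−t)⟪∇u(t,x) ξ, ξ⟫ > θ`
(`ξ = ω/|ω|`). Zoom-in at the origin (`stub_zoomExtraction`), persistence of the singularity
(`stub_limitSingular`, `classPressure_holds`), convergence of gradients
(`tendsto_fderiv_apply_of_typeI`), and the far-past rung `farPastStretchingRung` on the limit. [cite: AlbrittonBarker2019, Lemma 2.2 and Prop. 2.3 (arXiv:1811.00502)] -/
theorem singularStretchingNearZero {C : ℝ}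
    {u : ℝ → EuclideanSpace ℝ (Fin 3) → EuclideanSpace ℝ (Fin 3)} (hu : IsTypeIAncientMild C u)
    (hE : ∀ (x₀ : EuclideanSpace ℝ (Fin 3)) (t₀ r : ℝ), t₀ ≤ 0 → 0 < r →
      (∀ t, t₀ - r ^ 2 < t → t < t₀ → r⁻¹ * ∫ x in Metric.ball x₀ r, ‖u t x‖ ^ 2 ≤ C) ∧
        r⁻¹ * ∫ t in Set.Ioo (t₀ - r ^ 2) t₀, ∫ x in Metric.ball x₀ r, ‖fderiv ℝ (u t) x‖ ^ 2 ≤ C)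
    (hsing : ∀ r > 0, ∀ M : ℝ, ∃ t ∈ Set.Ioo (-(r ^ 2)) (0 : ℝ),
      ∃ x ∈ Metric.ball (0 : EuclideanSpace ℝ (Fin 3)) r, M < ‖u t x‖)
    {T θ : ℝ} (hT : T < 0) (hθ : θ < 1) :
    ∃ t ∈ Set.Ioo T 0, ∃ x, curl (u t) x ≠ 0 ∧
      θ < (-t) * ⟪fderiv ℝ (u t) x (vorticityDirection (curl (u t)) x),
        vorticityDirection (curl (u t)) x⟫ := by
  by_contra H
  push Not at H
  -- the zooms `u_{c_j}`, `c_j = 1/(j+1) → 0`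
  set c : ℕ → ℝ := fun j => 1 / ((j : ℝ) + 1) with hcdef
  have hc : ∀ j, 0 < c j := fun j => by rw [hcdef]; positivity
  obtain ⟨φ, hφ, W, hW, -, hpt⟩ := stub_zoomExtraction C u hu hE c hc
  -- the limit is singular at the origin, hence nonzero somewhere
  have hWsing := stub_limitSingular classPressure_holds C u hu hE hsing (fun j => c (φ j))
    (fun j => hc (φ j)) W hpt
  obtain ⟨t₀, ht₀, x₀, -, hx₀⟩ := hWsing 1 one_pos 0
  have hWne : W t₀ x₀ ≠ 0 := fun h => by simp [h] at hx₀
  -- the zoomed sequence: in the class, with the class-uniform Hessian bound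
  set w : ℕ → ℝ → EuclideanSpace ℝ (Fin 3) → EuclideanSpace ℝ (Fin 3) :=
    fun j => c (φ j) • stPull (c (φ j) ^ 2) (c (φ j)) 0 0 u with hwdef
  have hw : ∀ j, IsTypeIAncientMild C (w j) := fun j => isTypeIAncientMild_zoom hu (hc (φ j)) 0
  obtain ⟨K, -, hK⟩ := uniformBounds_exists_mixed 2 0 (-(3 : ℝ) / 2) (by norm_num)
  have h2x : ∀ n, ∀ t < 0, ∀ x, ‖iteratedFDeriv ℝ 2 (w n t) x‖ ≤ K C * (-t) ^ (-(3 : ℝ) / 2) := by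
    intro n t ht x
    have := hK C (w n) (hw n) t ht x
    simpa only [iteratedDeriv_zero] using this
  -- the scales of the subsequence tend to zero
  have hc0 : Tendsto (fun n => c (φ n)) atTop (𝓝 0) :=
    tendsto_one_div_add_atTop_nhds_zero_nat.comp hφ.tendsto_atTop
  -- the limit inherits the stretching bound at ALL negative times
  have HW : ∀ t < 0, ∀ x, curl (W t) x ≠ 0 →
      (-t) * ⟪fderiv ℝ (W t) x (vorticityDirection (curl (W t)) x),
        vorticityDirection (curl (W t)) x⟫ ≤ θ := by
    intro t ht x hωW
    -- gradients, curls, directions and stretching rates converge at `(t, x)`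
    have hgrad : Tendsto (fun n => fderiv ℝ (w n t) x) atTop (𝓝 (fderiv ℝ (W t) x)) :=
      tendsto_clm_of_tendsto_apply fun e => tendsto_fderiv_apply_of_typeI hw hW hpt h2x ht x e
    have hcurl : Tendsto (fun n => curl (w n t) x) atTop (𝓝 (curl (W t) x)) := by
      simp only [curl_eq_curlCLM]
      exact (curlCLM.continuous.tendsto _).comp hgrad
    have hne : ∀ᶠ n in atTop, curl (w n t) x ≠ 0 := hcurl.eventually_ne hωW
    have hξ : Tendsto (fun n => vorticityDirection (curl (w n t)) x) atTop
        (𝓝 (vorticityDirection (curl (W t)) x)) := by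
      simp only [vorticityDirection_apply]
      exact ((hcurl.norm).inv₀ (norm_ne_zero_iff.2 hωW)).smul hcurl
    have happ : Tendsto (fun n => fderiv ℝ (w n t) x (vorticityDirection (curl (w n t)) x)) atTop
        (𝓝 (fderiv ℝ (W t) x (vorticityDirection (curl (W t)) x))) :=
      ((isBoundedBilinearMap_apply (𝕜 := ℝ) (E := EuclideanSpace ℝ (Fin 3))
        (F := EuclideanSpace ℝ (Fin 3))).continuous.tendsto
          (fderiv ℝ (W t) x, vorticityDirection (curl (W t)) x)).comp (hgrad.prodMk_nhds hξ)
    have hstr : Tendsto (fun n => (-t) * ⟪fderiv ℝ (w n t) x (vorticityDirection (curl (w n t)) x),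
        vorticityDirection (curl (w n t)) x⟫) atTop
        (𝓝 ((-t) * ⟪fderiv ℝ (W t) x (vorticityDirection (curl (W t)) x),
          vorticityDirection (curl (W t)) x⟫)) :=
      (happ.inner hξ).const_mul (-t)
    -- the zooms obey the bound as soon as `c² t ∈ (T, 0)` and their vorticity is nonzero
    have hct : Tendsto (fun n => c (φ n) ^ 2 * t) atTop (𝓝 0) := by
      have := (hc0.pow 2).mul_const t
      simpa using this
    have hevT : ∀ᶠ n in atTop, T < c (φ n) ^ 2 * t := hct.eventually (eventually_gt_nhds hT)
    have hev : ∀ᶠ n in atTop, (-t) * ⟪fderiv ℝ (w n t) x (vorticityDirection (curl (w n t)) x),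
        vorticityDirection (curl (w n t)) x⟫ ≤ θ := by
      filter_upwards [hne, hevT] with n hn hnT
      have hcn : 0 < c (φ n) := hc (φ n)
      have hct0 : c (φ n) ^ 2 * t < 0 := mul_neg_of_pos_of_neg (by positivity) ht
      -- nonzero vorticity of `u` at the zoomed point
      have hω' : curl (u (c (φ n) ^ 2 * t)) (c (φ n) • x) ≠ 0 := by
        intro h0
        apply hn
        show curl ((c (φ n) • stPull (c (φ n) ^ 2) (c (φ n)) 0 0 u) t) x = 0
        rw [curl_nsZoom_origin, h0, smul_zero]
      have key := H (c (φ n) ^ 2 * t) ⟨hnT, hct0⟩ (c (φ n) • x) hω'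
      show (-t) * ⟪fderiv ℝ ((c (φ n) • stPull (c (φ n) ^ 2) (c (φ n)) 0 0 u) t) x
          (vorticityDirection (curl ((c (φ n) • stPull (c (φ n) ^ 2) (c (φ n)) 0 0 u) t)) x),
          vorticityDirection (curl ((c (φ n) • stPull (c (φ n) ^ 2) (c (φ n)) 0 0 u) t)) x⟫ ≤ θ
      rw [gaugeStretching_nsZoom_origin hcn]
      exact key
    exact le_of_tendsto hstr hev
  -- the far-past rung kills the limit: contradiction with its singularity
  have hW0 : ∀ s < 0, ∀ y, W s y = 0 :=
    farPastStretchingRung hW (T := 0) le_rfl hθ fun s hs y hωy => HW s hs y hωy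
  exact hWne (hW0 t₀ ht₀.2 x₀)

/-- **Stub `stub_singularStretchingNearZero` (crux stmt-NavierStokesRegularity-10570, line
`registered`, portrait clause), in the vocabulary of the route's class `𝒦_C`** (the hypotheses of
`ClockCeiling` verbatim: the Oseen–Koch–Tataru kernel written out through
`UnboundedOperators.heatKernel`): a SINGULAR element of `𝒦_C` has, for every `T < 0` and
`θ < 1`, a point `T < t < 0`, `x` with nonzero vorticity and gauge stretching rate
`(−t)⟪∇u(t,x) ξ, ξ⟫ > θ` along the vorticity direction. [cite: AlbrittonBarker2019, Lemma 2.2 and Prop. 2.3 (arXiv:1811.00502)] -/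
theorem stub_singularStretchingNearZero :
    ∀ (C : ℝ) (u : ℝ → EuclideanSpace ℝ (Fin 3) → EuclideanSpace ℝ (Fin 3)), (ContDiffOn ℝ (⊤ : ℕ∞) (Function.uncurry u) (Set.Iio 0 ×ˢ Set.univ) ∧ (∀ t < 0, Literature.Analysis.FluidPDE.VectorCalculus.IsDivFree (u t)) ∧ (∀ s t : ℝ, s < t → t < 0 → ∀ x, u t x = Literature.Analysis.FluidPDE.heatFlow (u s) (t - s) x - ∫ τ in Set.Ioo s t, ∫ y, ((-(inner ℝ (x - y) (u τ y) / (2 * (t - τ)) * Literature.Analysis.UnboundedOperators.heatKernel (t - τ) (x - y))) • u τ y + (∫ σ in Set.Ioi (t - τ), Literature.Analysis.UnboundedOperators.heatKernel σ (x - y) / (4 * σ ^ 2)) • (inner ℝ (x - y) (u τ y) • u τ y + inner ℝ (u τ y) (u τ y) • (x - y) + inner ℝ (x - y) (u τ y) • u τ y) - ((∫ σ in Set.Ioi (t - τ), Literature.Analysis.UnboundedOperators.heatKernel σ (x - y) / (8 * σ ^ 3)) * (inner ℝ (x - y) (u τ y) * inner ℝ (x - y) (u τ y))) • (x - y))) ∧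 Literature.Analysis.FluidPDE.HasTypeITimeDecay C u ∧ (∀ (x₀ : EuclideanSpace ℝ (Fin 3)) (t₀ r : ℝ), t₀ ≤ 0 → 0 < r → (∀ t, t₀ - r ^ 2 < t → t < t₀ → r⁻¹ * ∫ x in Metric.ball x₀ r, ‖u t x‖ ^ 2 ≤ C) ∧ r⁻¹ * ∫ t in Set.Ioo (t₀ - r ^ 2) t₀, ∫ x in Metric.ball x₀ r, ‖fderiv ℝ (u t) x‖ ^ 2 ≤ C)) →
      (∀ r > 0, ∀ M : ℝ, ∃ t ∈ Set.Ioo (-(r ^ 2)) (0 : ℝ), ∃ x ∈ Metric.ball (0 : EuclideanSpace ℝ (Fin 3)) r, M < ‖u t x‖) →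
      ∀ T < 0, ∀ θ < 1, ∃ t ∈ Set.Ioo T 0, ∃ x : EuclideanSpace ℝ (Fin 3),
        Literature.Analysis.FluidPDE.curl (u t) x ≠ 0 ∧
        θ < (-t) * inner ℝ (fderiv ℝ (u t) x
          (Literature.Analysis.FluidPDE.vorticityDirection (Literature.Analysis.FluidPDE.curl (u t)) x))
          (Literature.Analysis.FluidPDE.vorticityDirection (Literature.Analysis.FluidPDE.curl (u t)) x) := by
  intro C u hu hsing T hT θ hθ
  have hTI : IsTypeIAncientMild C u :=
    isTypeIAncientMild_iff.2 ⟨hu.1, hu.2.1, hu.2.2.1, hu.2.2.2.1⟩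
  exact singularStretchingNearZero hTI hu.2.2.2.2 hsing hT hθ

end Summit.NavierStokesRegularity.NavierStokesRegularity.Theorems

end
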